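import Mathlib.Analysis.SpecialFunctions.Exponential
import Literature.Barriers.CriticalPhenomena.RigorousRGSmallParameterHierarchicalIsing
import HarnessLib

/-!
# The Taylor-coefficient recursion (5.4), (5.6), (5.7) of Hara–Hattori–Watanabe §5.1, exactly

Support file for the computer-aided half `HaraHattoriWatanabe2001_thm22` (HHW 2001, Theorem 2.2,
§5) of `HaraHattoriWatanabe2001_thm11` (`RigorousRGSmallParameterHHWReduction.lean`). §5 proves
Theorem 2.2 "by (computer-aided) brute force evaluation of the Taylor coefficients of `ĥ_N(ξ)`":
`ĥ_N(ξ) = Σ_n (-1)ⁿ a_{n,N} ξ^{2n}/n!` ((5.1), `a_{n,N} = n! m_{2n}/(2n)!` = `HierarchicalRG.taylorA`),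
with the recursion
* (5.4) `b_{n,N} = (c/4)ⁿ Σ_ℓ C(n,ℓ) a_{ℓ,N} a_{n-ℓ,N}` (rescaled pair law `S`),
* (5.6) `ã_{n,N} = Σ_{m ≥ 0} (β/2)^m b_{m+n,N} (2m+2n)! n!/(m!(m+n)!(2n)!)` (Gaussian tilt `T`),
* (5.7) `a_{n,N+1} = ã_{n,N}/ã_{0,N}` (normalisation),
followed by the truncation bounds of Proposition 5.1 and 70-digit interval arithmetic.

This file PROVES (5.4), (5.6), (5.7) as exact identities for the transcription
`traj s N = R^N h_{I,s}` (`taylorA_traj_succ`), through the finite Dirac-sum form of `h_N`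
(`iterate_rgMap_isingLaw`, `rgMap_fsLaw` of `RigorousRGSmallParameterHierarchicalIsing.lean`):
moments of a finite family (`fsMoment`, `fsTaylorA`, `taylorA_fsLaw`), one block-spin step on
them (`pairVal`, `pairWeight`, `tiltedSum`, `taylorA_rgMap_fsLaw` = (5.7)), the tilted sums as
exponential series in the pair moments (`hasSum_tiltedSum`, `e^{βy²/2} = Σ_m (βy²/2)^m/m!`),
(5.4) for flip-symmetric families (`fsB_eq`, binomial theorem; `fsMoment_odd_eq_zero`) and (5.6)
(`hasSum_aTilde`). Nothing is left as a fact. The truncation (Proposition 5.1, which needs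
Newman's `a_n ≤ a_1ⁿ` (5.3)/(5.5) and `a_{M+N} ≤ a_M a_N` (A.6)) and the verified numerics are
NOT here.

Feasibility note for the numerics (recorded for whoever formalises Theorem 2.2): a prototype of
Proposition 5.1's recursion (5.8)–(5.14) in directed-rounding floating-point interval arithmetic
(mantissa 300 bits, `M = 50` coefficients, `e^{-x} ≤ 1` in (5.13)) reproduces the printed
enclosures of §5.3 to 11 digits at `N = 100` (`μ_{2,100}(s₋) ∈ [0.99609586499, 0.99609586501]`,
`μ_{2,100}(s₊) ∈ [1.01318579036, 1.01318579039]`, `μ_{4,100}(s₊) ∈ [0.0028102709, 0.0028102710]`,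
`μ_{4,70} ≈ 0.004143 ≤ 0.0045`) in 5 s of CPython big-integer arithmetic for both endpoints
`s±`; relative widths double per step. FIXED-point (absolute-precision) intervals fail, because
`a_{n,N}` spans hundreds of orders of magnitude: the kernel implementation must use floating
intervals. With the same prototype, all checks of §5.3 come out as printed (`μ̄_{4,70} = 0.0041438`,
`μ̲₆/μ̄₄² = 3.6459`, `μ̄₆/μ̲₄² = 3.7541`, `μ̄₈/μ̲₄³ = 38.488`, `max_{70≤N<100} ā₁(s₊) = 1.011`).
Addendum for the CORRECTED Theorem 2.1 of `RigorousRGSmallParameterHHWThm21Statement.lean` (its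
strip hypothesis, the critical mass condition (2.13) at the levels `70 ≤ N < 100` on the level-`100`
window): bisection with the prototype locates the window inside a bracket of width `3.4·10⁻¹⁷`
(`s̲₁₀₀ ≈ s₋ + 2.3·10⁻¹⁷`, `s̄₁₀₀ ≈ s₊ - 4.3·10⁻¹⁷`), and on that bracket — subdivided into 48
pieces, the top three further into 60 sub-pieces of width `3.5·10⁻²⁰`, endpoint enclosures
combined by the monotonicity (5.34) — (2.13) is verified at EVERY level `70 ≤ N ≤ 99` (minimal
upper margin `+5.6·10⁻⁵` at `N = 99` near `s̄₁₀₀`, lower margins `≥ 1.7·10⁻³`). So a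
strengthened Theorem 2.2 that also certifies the strip hypothesis is numerically within reach (it
needs the window to `~10⁻²⁴` and `~100` sub-intervals rather than the two points `s±`); these are
unverified prototype computations, recorded here only to guide the formalisation.
(Session notes of the `HaraHattoriWatanabe2001_thm11` literature item, 2026-08-15.)

## References

* T. Hara, T. Hattori, H. Watanabe, Comm. Math. Phys. 220 (2001) 13–40, §5.1 (pp. 14–15),
  eqs. (5.1)–(5.7); Proposition 5.1 (pp. 16–19); §5.3 (pp. 19–20).
-/

noncomputable section

namespace Literature.Barriers.CriticalPhenomena

open _root_.MeasureTheory _root_.ProbabilityTheory _root_.Filter _root_.Set _root_.Finset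
open scoped _root_.Topology _root_.ENNReal _root_.NNReal BigOperators

namespace HierarchicalRG

variable {ι : Type*} [Fintype ι]

/-! ### Moments and Taylor coefficients of a finite Dirac sum -/

/-- `m_k(Σ W_i δ_{x_i}) = Σ W_i x_iᵏ`. [folklore] -/
theorem moment_fsLaw (W : ι → ℝ≥0) (x : ι → ℝ) (k : ℕ) :
    moment id k (fsLaw W x) = ∑ i, (W i : ℝ) * x i ^ k := by
  rw [moment_id_eq, integral_fsLaw]
  simp [smul_eq_mul]

/-- The raw moments `m_k = Σ W_i x_iᵏ` of a finite family. [folklore] -/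
def fsMoment (W : ι → ℝ≥0) (x : ι → ℝ) (k : ℕ) : ℝ := ∑ i, (W i : ℝ) * x i ^ k

/-- The Taylor coefficients `a_n = n! m_{2n}/(2n)!` ((5.1)) of a finite family.
[cite: HaraHattoriWatanabe2001, §5.1 eq. (5.1)] -/
def fsTaylorA (W : ι → ℝ≥0) (x : ι → ℝ) (n : ℕ) : ℝ :=
  (n.factorial : ℝ) / ((2 * n).factorial : ℝ) * fsMoment W x (2 * n)

/-- `taylorA (Σ W_i δ_{x_i}) n = n! m_{2n}/(2n)!`. [cite: HaraHattoriWatanabe2001, §5.1 eq. (5.1)] -/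
theorem taylorA_fsLaw (W : ι → ℝ≥0) (x : ι → ℝ) (n : ℕ) :
    taylorA (fsLaw W x) n = fsTaylorA W x n := by
  rw [taylorA, moment_fsLaw]; rfl

/-! ### One block-spin step on the Taylor coefficients: (5.4), (5.6), (5.7) -/

section Step

variable (c : ℝ) (W : ι → ℝ≥0) (x : ι → ℝ)

/-- The block-spin values `y_{ij} = (√c/2)(x_i + x_j)` of the pair law. [cite: HaraHattoriWatanabe2001, §1 eq. (1.2)] -/
def pairVal (p : ι × ι) : ℝ := Real.sqrt c / 2 * (x p.1 + x p.2)

/-- The pair weights `W_iW_j`. [folklore] -/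
def pairWeight (p : ι × ι) : ℝ≥0 := W p.1 * W p.2

/-- The tilted sums `T_k = Σ_{ij} W_iW_j y_{ij}ᵏ e^{βy_{ij}²/2}` (unnormalised moments of `Rh`).
[cite: HaraHattoriWatanabe2001, §1 eq. (1.2)] -/
def tiltedSum (k : ℕ) : ℝ :=
  ∑ p : ι × ι, (pairWeight W p : ℝ) * pairVal c x p ^ k * Real.exp (beta c / 2 * pairVal c x p ^ 2)

/-- `b_n = n! M_{2n}/(2n)!` for the pair law `(√c/2)(X + X')` ((5.4), left side).
[cite: HaraHattoriWatanabe2001, §5.1 eq. (5.4)] -/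
def fsB (n : ℕ) : ℝ := fsTaylorA (pairWeight W) (pairVal c x) n

/-- **(5.7): `a_{n,N+1} = ã_n/ã_0` with `ã_n = n! T_{2n}/(2n)!`** — the Taylor coefficients after
one step are the normalised tilted pair sums. [cite: HaraHattoriWatanabe2001, §5.1 eq. (5.7)] -/
theorem taylorA_rgMap_fsLaw (n : ℕ) :
    taylorA (rgMap c (fsLaw W x)) n =
      ((n.factorial : ℝ) / ((2 * n).factorial : ℝ) * tiltedSum c W x (2 * n)) / tiltedSum c W x 0 := by
  rw [rgMap_fsLaw, taylorA_fsLaw, fsTaylorA, fsMoment]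
  have hZ : ∀ q : ι × ι, 0 ≤ (W q.1 : ℝ) * W q.2 *
      Real.exp (beta c / 2 * (Real.sqrt c / 2 * (x q.1 + x q.2)) ^ 2) := fun q => by positivity
  set Z := ∑ q : ι × ι, (W q.1 : ℝ) * W q.2 *
      Real.exp (beta c / 2 * (Real.sqrt c / 2 * (x q.1 + x q.2)) ^ 2) with hZdef
  have hZ0 : tiltedSum c W x 0 = Z := by
    simp [tiltedSum, pairWeight, pairVal, hZdef]
  rw [hZ0, mul_div_assoc]
  congr 1
  unfold tiltedSum
  rw [Finset.sum_div]
  refine Finset.sum_congr rfl fun p _ => ?_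
  have hcoe : ((W p.1 * W p.2 * (Real.exp (beta c / 2 * (Real.sqrt c / 2 * (x p.1 + x p.2)) ^ 2) / Z).toNNReal
      : ℝ≥0) : ℝ) = (W p.1 : ℝ) * W p.2 *
        (Real.exp (beta c / 2 * (Real.sqrt c / 2 * (x p.1 + x p.2)) ^ 2) / Z) := by
    push_cast
    rw [Real.coe_toNNReal _ (div_nonneg (Real.exp_pos _).le (Finset.sum_nonneg fun q _ => hZ q))]
  rw [hcoe]
  simp only [pairWeight, pairVal, NNReal.coe_mul]
  ring

/-- **The tilted sums as exponential series in the pair moments**: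
`T_k = Σ_m (β/2)^m/m! · M_{k+2m}`, `M_j = Σ_{ij} W_iW_j y_{ij}ʲ` (`e^{βy²/2} = Σ_m (βy²/2)^m/m!`).
[cite: HaraHattoriWatanabe2001, §5.1 eq. (5.6)] -/
theorem hasSum_tiltedSum (k : ℕ) :
    HasSum (fun m : ℕ => (beta c / 2) ^ m / (m.factorial : ℝ) *
      fsMoment (pairWeight W) (pairVal c x) (k + 2 * m)) (tiltedSum c W x k) := by
  unfold tiltedSum fsMoment
  simp_rw [Finset.mul_sum]
  refine hasSum_sum fun p _ => ?_
  have h := NormedSpace.expSeries_div_hasSum_exp (beta c / 2 * pairVal c x p ^ 2)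
  rw [← congrFun Real.exp_eq_exp_ℝ] at h
  have := h.mul_left ((pairWeight W p : ℝ) * pairVal c x p ^ k)
  refine this.congr_fun fun m => ?_
  simp only [pow_add, pow_mul, mul_pow]
  ring

/-- **(5.4): `b_n = (c/4)ⁿ Σ_ℓ C(n,ℓ) a_ℓ a_{n-ℓ}`** for an EVEN family (odd moments vanish):
the Taylor coefficients of the rescaled pair law. [cite: HaraHattoriWatanabe2001, §5.1 eq. (5.4)] -/
theorem fsB_eq (hc : 0 ≤ c) (hodd : ∀ k, fsMoment W x (2 * k + 1) = 0) (n : ℕ) :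
    fsB c W x n = (c / 4) ^ n * ∑ l ∈ Finset.range (n + 1),
      (n.choose l : ℝ) * fsTaylorA W x l * fsTaylorA W x (n - l) := by
  -- even/odd splitting of a sum over `range (2n+1)`
  have hsplit : ∀ (f : ℕ → ℝ) (n : ℕ), ∑ r ∈ Finset.range (2 * n + 1), f r =
      ∑ l ∈ Finset.range (n + 1), f (2 * l) + ∑ l ∈ Finset.range n, f (2 * l + 1) := by
    intro f n
    induction n with
    | zero => simp
    | succ n ih =>
      rw [show 2 * (n + 1) + 1 = (2 * n + 1) + 1 + 1 from by ring, Finset.sum_range_succ,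
        Finset.sum_range_succ, ih, Finset.sum_range_succ (fun l => f (2 * l)) (n + 1),
        Finset.sum_range_succ (fun l => f (2 * l + 1)) n, show 2 * n + 1 + 1 = 2 * (n + 1) from by ring]
      ring
  -- the pair moment of order `2n` via the binomial theorem
  have hM : fsMoment (pairWeight W) (pairVal c x) (2 * n) = (c / 4) ^ n *
      ∑ r ∈ Finset.range (2 * n + 1), ((2 * n).choose r : ℝ) * fsMoment W x r * fsMoment W x (2 * n - r) := by
    unfold fsMoment pairWeight pairVal
    have hc4 : ∀ y : ℝ, (Real.sqrt c / 2 * y) ^ (2 * n) = (c / 4) ^ n * y ^ (2 * n) := by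
      intro y
      rw [mul_pow, pow_mul, div_pow, Real.sq_sqrt hc, pow_mul]; norm_num
    simp_rw [hc4, add_pow]
    have key : ∀ r : ℕ, (c / 4) ^ n * (((2 * n).choose r : ℝ) * (∑ i, (W i : ℝ) * x i ^ r) *
        ∑ j, (W j : ℝ) * x j ^ (2 * n - r)) =
        ∑ i, ∑ j, (c / 4) ^ n * ((2 * n).choose r : ℝ) * (((W i : ℝ) * x i ^ r) * ((W j : ℝ) * x j ^ (2 * n - r))) := by
      intro r
      rw [show (c / 4) ^ n * (((2 * n).choose r : ℝ) * (∑ i, (W i : ℝ) * x i ^ r) *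
          ∑ j, (W j : ℝ) * x j ^ (2 * n - r)) = ((c / 4) ^ n * ((2 * n).choose r : ℝ)) *
          ((∑ i, (W i : ℝ) * x i ^ r) * ∑ j, (W j : ℝ) * x j ^ (2 * n - r)) by ring,
        Finset.sum_mul_sum, Finset.mul_sum]
      simp_rw [Finset.mul_sum]
    rw [Finset.mul_sum]
    simp_rw [key]
    rw [Fintype.sum_prod_type]
    conv_rhs => rw [Finset.sum_comm]
    refine Finset.sum_congr rfl fun i _ => ?_
    conv_rhs => rw [Finset.sum_comm]
    refine Finset.sum_congr rfl fun j _ => ?_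
    rw [Finset.mul_sum, Finset.mul_sum]
    refine Finset.sum_congr rfl fun r _ => ?_
    push_cast
    ring
  rw [fsB, fsTaylorA, hM, hsplit]
  -- odd terms vanish
  have hodd' : ∑ l ∈ Finset.range n, ((2 * n).choose (2 * l + 1) : ℝ) * fsMoment W x (2 * l + 1) *
      fsMoment W x (2 * n - (2 * l + 1)) = 0 :=
    Finset.sum_eq_zero fun l _ => by rw [hodd l]; ring
  rw [hodd', add_zero, Finset.mul_sum, Finset.mul_sum, Finset.mul_sum]
  refine Finset.sum_congr rfl fun l hl => ?_
  have hln : l ≤ n := Nat.lt_succ_iff.1 (Finset.mem_range.1 hl)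
  rw [show 2 * n - 2 * l = 2 * (n - l) by omega]
  simp only [fsTaylorA]
  -- factorial bookkeeping: `n!/(2n)! C(2n,2l) m_{2l} m_{2n-2l} = C(n,l) a_l a_{n-l}`
  rw [Nat.cast_choose ℝ (by omega : 2 * l ≤ 2 * n), Nat.cast_choose ℝ hln,
    show 2 * n - 2 * l = 2 * (n - l) by omega]
  have h1 : ((2 * n).factorial : ℝ) ≠ 0 := by positivity
  have h2 : ((2 * l).factorial : ℝ) ≠ 0 := by positivity
  have h3 : ((2 * (n - l)).factorial : ℝ) ≠ 0 := by positivity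
  have h4 : (l.factorial : ℝ) ≠ 0 := by positivity
  have h5 : ((n - l).factorial : ℝ) ≠ 0 := by positivity
  field_simp

/-- **(5.6): `ã_n = Σ_m (β/2)^m b_{m+n} (2m+2n)! n!/(m!(m+n)!(2n)!)`** — the (unnormalised) Taylor
coefficients after the Gaussian tilt as a convergent series in the `b`'s.
[cite: HaraHattoriWatanabe2001, §5.1 eq. (5.6)] -/
theorem hasSum_aTilde (n : ℕ) :
    HasSum (fun m : ℕ => (beta c / 2) ^ m * fsB c W x (m + n) *
      (((2 * m + 2 * n).factorial : ℝ) * n.factorial /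
        ((m.factorial : ℝ) * (m + n).factorial * (2 * n).factorial)))
      ((n.factorial : ℝ) / ((2 * n).factorial : ℝ) * tiltedSum c W x (2 * n)) := by
  have h := (hasSum_tiltedSum c W x (2 * n)).mul_left ((n.factorial : ℝ) / ((2 * n).factorial : ℝ))
  refine h.congr_fun fun m => ?_
  simp only [fsB, fsTaylorA]
  rw [show 2 * n + 2 * m = 2 * (m + n) by ring, show 2 * m + 2 * n = 2 * (m + n) by ring]
  have h1 : ((2 * n).factorial : ℝ) ≠ 0 := by positivity
  have h2 : ((2 * (m + n)).factorial : ℝ) ≠ 0 := by positivity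
  have h4 : (m.factorial : ℝ) ≠ 0 := by positivity
  have h5 : ((m + n).factorial : ℝ) ≠ 0 := by positivity
  field_simp

/-- Odd moments of a flip-symmetric family vanish. [folklore] -/
theorem fsMoment_odd_eq_zero (e : ι ≃ ι) (hW : ∀ i, W (e i) = W i) (hx : ∀ i, x (e i) = -x i)
    (k : ℕ) : fsMoment W x (2 * k + 1) = 0 := by
  have h : fsMoment W x (2 * k + 1) = -fsMoment W x (2 * k + 1) := by
    unfold fsMoment
    conv_lhs => rw [← e.sum_comp]
    simp only [hW, hx, ← Finset.sum_neg_distrib]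
    refine Finset.sum_congr rfl fun i _ => ?_
    rw [neg_pow, pow_succ (-1 : ℝ), pow_mul]
    norm_num
  linarith

end Step

/-! ### The recursion along the `d = 4` trajectory -/

/-- The `b`-vector of (5.4) built from a coefficient sequence `a` (`c = √2`, `c/4 = √2/4`).
[cite: HaraHattoriWatanabe2001, §5.1 eq. (5.4)] -/
def bOf (a : ℕ → ℝ) (k : ℕ) : ℝ :=
  (Real.sqrt 2 / 4) ^ k * ∑ l ∈ Finset.range (k + 1), (k.choose l : ℝ) * a l * a (k - l)

/-- The coefficient `(2m+2n)! n!/(m!(m+n)!(2n)!)` of (5.6). [cite: HaraHattoriWatanabe2001, §5.1 eq. (5.6)] -/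
def tildeCoef (m n : ℕ) : ℝ :=
  ((2 * m + 2 * n).factorial : ℝ) * n.factorial /
    ((m.factorial : ℝ) * (m + n).factorial * (2 * n).factorial)

/-- **The Taylor coefficients along the trajectory obey (5.4), (5.6), (5.7) EXACTLY**: with
`a_l = a_{l,N} = taylorA h_N l` and `b_k = (c/4)ᵏ Σ_l C(k,l) a_l a_{k-l}`, there are numbers
`ã_n` (the normalised-free tilted sums) with `ã_n = Σ_m (β/2)^m b_{m+n} (2m+2n)!n!/(m!(m+n)!(2n)!)`
(a convergent series) and `a_{n,N+1} = ã_n/ã_0`. Proved for the transcription `traj` via the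
finite Dirac-sum form of `h_N` (`iterate_rgMap_isingLaw`) and its spin-flip symmetry.
[cite: HaraHattoriWatanabe2001, §5.1 eqs. (5.4), (5.6), (5.7)] -/
theorem taylorA_traj_succ (s : ℝ) (N : ℕ) :
    ∃ T : ℕ → ℝ, (∀ n, HasSum (fun m : ℕ => (beta (Real.sqrt 2) / 2) ^ m *
        bOf (fun l => taylorA (traj s N) l) (m + n) * tildeCoef m n) (T n)) ∧
      (∀ n, taylorA (traj s (N + 1)) n = T n / T 0) ∧ 0 < T 0 := by
  set c := Real.sqrt 2 with hc
  set W := gibbsWeight c s N with hW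
  set x := blockVal c s N with hx
  have htraj : traj s N = fsLaw W x := iterate_rgMap_isingLaw c s N
  have htraj' : traj s (N + 1) = rgMap c (fsLaw W x) := by rw [traj_succ, htraj]
  have hodd : ∀ k, fsMoment W x (2 * k + 1) = 0 := by
    refine fsMoment_odd_eq_zero W x (Equiv.mk (fun σ θ => !σ θ) (fun σ θ => !σ θ)
      (fun σ => by funext θ; simp) (fun σ => by funext θ; simp)) (fun σ => ?_) (fun σ => ?_)
    · simp only [Equiv.coe_fn_mk, hW, gibbsWeight, isingWeight_not]
    · simp only [Equiv.coe_fn_mk, hx, blockVal_not]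
  have hc0 : 0 ≤ c := Real.sqrt_nonneg 2
  refine ⟨fun n => (n.factorial : ℝ) / ((2 * n).factorial : ℝ) * tiltedSum c W x (2 * n),
    fun n => ?_, fun n => ?_, ?_⟩
  · have h := hasSum_aTilde c W x n
    refine h.congr_fun fun m => ?_
    have ha : ∀ l, taylorA (traj s N) l = fsTaylorA W x l := fun l => by rw [htraj, taylorA_fsLaw]
    rw [fsB_eq c W x hc0 hodd (m + n)]
    simp only [bOf, tildeCoef, ha, hc, div_pow]
  · rw [htraj', taylorA_rgMap_fsLaw]
    simp
  · simp only [Nat.factorial_zero, Nat.cast_one, mul_zero, div_one, one_mul]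
    unfold tiltedSum
    refine Finset.sum_pos (fun p _ => ?_) Finset.univ_nonempty
    simp only [pow_zero, mul_one]
    refine mul_pos ?_ (Real.exp_pos _)
    simp only [pairWeight, hW, NNReal.coe_mul, coe_gibbsWeight]
    exact mul_pos (div_pos (isingWeight_pos c s N _) (partitionZ_pos c s N))
      (div_pos (isingWeight_pos c s N _) (partitionZ_pos c s N))

end HierarchicalRG

end Literature.Barriers.CriticalPhenomena

end
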